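import Summits.ValiantsHypothesis.ValiantsHypothesis.Theorems.DefinabilityGapSlideCount
import HarnessLib

/-!
# Definability gap — the z-side SLIDE SUPPORT LEMMA and the level tools for `hB`-patch lists

Helper-lane file F-N₂a of OFFER O-L5-LEVEL (decomp-val-lens-5 g40; RULING + CALL GO decomp-val-crit-1 g11, file plan
confirmed in ACK·BUILD-1) on the `KIPlantedHittingRO` helper lane (`stmt-ValiantsHypothesis-23704`). Notation: block
labels `B = Fin 3 → Fin (qOf m)`, GATES `eprod E = Π_{(u,v) ∈ E} (z_u − z_v)` of `DefinabilityGapEdgeGates`, the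
RELABEL-COLLAPSE `ρ_e := rename (repL [e])` (`z_v ↦ z_u` for `e = (u, v)`, `repL` of `DefinabilityGapClusterMerging`)
acting on edges by `d ↦ (repL [e] d.1, repL [e] d.2)`, and the level-`L` PATCHED SUBSTITUTION
`φ_L := bind₁ (fun c => wordPoly m (wordL m L c))` for a patch list `L` whose merged-away labels `p.2` are pairwise
distinct (`hB`) — no vertex-disjointness, no `Nodup`. DEF-FREE: theorems only. Contents:

* `eq_or_swap_of_repL_eq`: `ρ_e` creates a loop only on `e` itself (as an unordered pair); `sym2_ne_of_toLex_lt`: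
  different ORIENTED edges are different unordered pairs; `eprod_ne_zero`: a loopless gate is nonzero in `ℂ[z]`;
  `eprod_map_repL_eq_zero`: collapsing along one of its own edges kills a gate; `rename_repL_threeGates`.
* SLIDE SUPPORT LEMMA `slide_of_rename_eq_zero` (no UFD, no primality): if `ρ_e (β·eprod E + γ·eprod E') = 0` with
  `γ ≠ 0` and the edges of `E'` loopless and `≠ e` as unordered pairs, then every edge `g` of `E` has a PARTNER
  `g' ∈ E'` with the same collapse, `Sym2.map r_e {g} = Sym2.map r_e {g'}`. Proof: collapse once more along the image
  `ĝ` of `g`; the image of the first gate dies (a loop), so the twice-collapsed second gate vanishes in the DOMAIN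
  `ℂ[z]`, i.e. one of its edges became a loop, i.e. an edge of `E'` has the collapse `ĝ`. Three-gate form
  `slide_of_rename_threeGates_eq_zero` (the first gate contains `e` and dies). These slides, in five directions, are
  the hypotheses of the VERTEX-SUPPORT COUNT `DefinabilityGapSlideCount.card_labels_le_four`.
* `vars_eprod_subset`, `vars_C_mul_eprod_subset`: the variables of a circuit term are endpoints of its edges.
* LEVEL TOOLS for `hB`-lists: SURVIVE `bind₁_wordL_eprod_ne_zero` (one gate on loopless live edges, `2·3^|L| < m²`,
  from `wordPoly_wordL_ne'`); THE PATCHED SUPPORT RUNG `bind₁_wordL_ne_zero'` (= `DefinabilityGapClusterMerging.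
  bind₁_wordL_ne_zero` re-keyed from `Nodup` + vertex-disjoint to `hB`, same NW-design proof: `card_agree_wordL_le`,
  `KIPrivate.bind₁_kiGenerator_perPoly_ne_zero`); `repL_live`, `map_repL_cond` (collapsed edges avoiding `e` are
  loopless and live at level `e :: L`); (E2′) MERGE KILLS TWO `bind₁_wordL_ne_zero_of_mem_mem` (an edge in two gates
  and avoided by the third: TRANSFER to `e :: L` via `bind₁_wordL_ne_zero_of_cons`, KILL both gates via
  `wordL_snd_eq`, CONTRACT the third via `bind₁_wordL_rename_repL`, SURVIVE — no prime avoidance); (E3a) FREE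
  COLLAPSE `bind₁_wordL_ne_zero_of_free` (`ρ_e f ≠ 0` for `e` in the first gate avoided by the two others ⟹
  `φ_L f ≠ 0` when `2·3^(|L|+2) < m²`: `ρ_e f` is a two-gate circuit live at level `e :: L`, TWO GATES UNDER PATCHES
  `bind₁_wordL_twoGates_ne_zero`, CONTRACT, TRANSFER `rename_mergeSub_bind₁_wordL`).

USE: F-N₂b `DefinabilityGapThreeGatesPatched` (THEOREM A: three equal-size graphical gates survive every `hB`-level)
and F-N₃ `DefinabilityGapGraphicalFour` (THEOREM B: fan-in 4, pairwise edge-disjoint gates, every support). HONEST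
BOUNDARY: tools only; 0 S-currency, closes NO item, `stmt-23704` / VP ≠ VNP untouched.
-/

open MvPolynomial
open Literature.Computability.AlgebraicComplexity Literature.Computability.MetaComplexity
open Summit.ValiantsHypothesis.ValiantsHypothesis.Theorems.DefinabilityGapAffineRung
open Summit.ValiantsHypothesis.ValiantsHypothesis.Theorems.DefinabilityGapBlockMerging
open Summit.ValiantsHypothesis.ValiantsHypothesis.Theorems.DefinabilityGapClusterMerging
open Summit.ValiantsHypothesis.ValiantsHypothesis.Theorems.DefinabilityGapForestSums
open Summit.ValiantsHypothesis.ValiantsHypothesis.Theorems.DefinabilityGapSupportRung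
open Summit.ValiantsHypothesis.ValiantsHypothesis.Theorems.DefinabilityGapEdgeGates

set_option linter.dupNamespace false

namespace Summit.ValiantsHypothesis.ValiantsHypothesis.Theorems.DefinabilityGapSlideSupport

variable {m : ℕ}

/-! ## The collapse `ρ_e = rename (repL [e])` on gates -/

/-- A collapse `r_e` creates a loop only on `e` itself (up to orientation). [this file] -/
theorem eq_or_swap_of_repL_eq (e d : (Fin 3 → Fin (qOf m)) × (Fin 3 → Fin (qOf m))) (hd : d.1 ≠ d.2)
    (h : repL [e] d.1 = repL [e] d.2) : s(d.1, d.2) = s(e.1, e.2) := by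
  have hrep : ∀ c : Fin 3 → Fin (qOf m), repL [e] c = if c = e.2 then e.1 else c := fun c => rfl
  rw [hrep, hrep] at h
  by_cases h1 : d.1 = e.2
  · by_cases h2 : d.2 = e.2
    · exact (hd (h1.trans h2.symm)).elim
    · rw [if_pos h1, if_neg h2] at h
      rw [h1, ← h]; exact Sym2.eq_swap
  · by_cases h2 : d.2 = e.2
    · rw [if_neg h1, if_pos h2] at h
      rw [h, h2]
    · rw [if_neg h1, if_neg h2] at h
      exact (hd h).elim

/-- A loopless gate is a nonzero polynomial of `ℂ[z]`. [this file] -/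
theorem eprod_ne_zero {E : Multiset ((Fin 3 → Fin (qOf m)) × (Fin 3 → Fin (qOf m)))}
    (hE : ∀ e ∈ E, e.1 ≠ e.2) : eprod E ≠ 0 := by
  intro h0
  rw [show eprod E = (E.map fun e => X e.1 - X e.2).prod from rfl, Multiset.prod_eq_zero_iff,
    Multiset.mem_map] at h0
  obtain ⟨e, he, h0⟩ := h0
  exact hE e he (X_injective (sub_eq_zero.1 h0))

/-- Two different ORIENTED edges are different as unordered pairs. [this file] -/
theorem sym2_ne_of_toLex_lt {d e : (Fin 3 → Fin (qOf m)) × (Fin 3 → Fin (qOf m))} (hd : toLex d.1 < toLex d.2)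
    (he : toLex e.1 < toLex e.2) (hne : d ≠ e) : s(d.1, d.2) ≠ s(e.1, e.2) := by
  intro h
  rcases Sym2.eq_iff.1 h with ⟨h1, h2⟩ | ⟨h1, h2⟩
  · exact hne (Prod.ext h1 h2)
  · rw [h1, h2] at hd
    exact lt_asymm he hd

/-- Collapsing along one of its own edges kills a gate (a loop appears). [this file] -/
theorem eprod_map_repL_eq_zero {G : Multiset ((Fin 3 → Fin (qOf m)) × (Fin 3 → Fin (qOf m)))}
    {g : (Fin 3 → Fin (qOf m)) × (Fin 3 → Fin (qOf m))} (hg : g ∈ G) :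
    eprod (G.map fun d => (repL [g] d.1, repL [g] d.2)) = 0 := by
  refine eprod_eq_zero_of_mem (u := g.1) (Multiset.mem_map.2 ⟨g, hg, Prod.ext ?_ ?_⟩)
  · show (if g.1 = g.2 then g.1 else g.1) = g.1
    rw [ite_self]
  · show (if g.2 = g.2 then g.1 else g.2) = g.1
    rw [if_pos rfl]

/-- `ρ_e` of a three-gate circuit with `e` in the first gate is the two-gate circuit of the collapsed other gates.
[this file] -/
theorem rename_repL_threeGates {E₁ E₂ E₃ : Multiset ((Fin 3 → Fin (qOf m)) × (Fin 3 → Fin (qOf m)))}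
    {e : (Fin 3 → Fin (qOf m)) × (Fin 3 → Fin (qOf m))} (he : e ∈ E₁) (α₁ α₂ α₃ : ℂ) :
    rename (repL [e]) (C α₁ * eprod E₁ + C α₂ * eprod E₂ + C α₃ * eprod E₃) =
      C α₂ * eprod (E₂.map fun d => (repL [e] d.1, repL [e] d.2)) +
        C α₃ * eprod (E₃.map fun d => (repL [e] d.1, repL [e] d.2)) := by
  rw [map_add, map_add, map_mul, map_mul, map_mul, rename_C, rename_C, rename_C, rename_eprod, rename_eprod,
    rename_eprod, eprod_map_repL_eq_zero he, mul_zero, zero_add]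

/-- SUPPORT LEMMA in slide form (no UFD): if the collapse `ρ_e` annihilates `β·eprod E + γ·eprod E'` (`γ ≠ 0`,
the edges of `E'` loopless and `≠ e` up to orientation), every edge of `E` has a partner in `E'` with the same
`r_e`-collapse (no hypothesis on `E` is needed). Proof: collapse once more along the image `ĝ` of `g ∈ E`;
the first gate dies, so the image of the second vanishes in the domain `ℂ[z]`, i.e. one of its edges became a
loop — an edge of `E'` with the collapse `ĝ`.
[this file] -/
theorem slide_of_rename_eq_zero {E E' : Multiset ((Fin 3 → Fin (qOf m)) × (Fin 3 → Fin (qOf m)))} {β γ : ℂ}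
    (hγ : γ ≠ 0) (e : (Fin 3 → Fin (qOf m)) × (Fin 3 → Fin (qOf m)))
    (hE' : ∀ d ∈ E', d.1 ≠ d.2 ∧ s(d.1, d.2) ≠ s(e.1, e.2))
    (h : rename (repL [e]) (C β * eprod E + C γ * eprod E') = 0) :
    ∀ g ∈ E, ∃ g' ∈ E', Sym2.map (fun c => if c = e.2 then e.1 else c) s(g.1, g.2) =
      Sym2.map (fun c => if c = e.2 then e.1 else c) s(g'.1, g'.2) := by
  intro g hg
  have hll : ∀ d : (Fin 3 → Fin (qOf m)) × (Fin 3 → Fin (qOf m)), d.1 ≠ d.2 → s(d.1, d.2) ≠ s(e.1, e.2) →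
      repL [e] d.1 ≠ repL [e] d.2 := fun d hd hde hq => hde (eq_or_swap_of_repL_eq e d hd hq)
  rw [map_add, map_mul, map_mul, rename_C, rename_C, rename_eprod, rename_eprod] at h
  have hgm : (repL [e] g.1, repL [e] g.2) ∈ E.map (fun d => (repL [e] d.1, repL [e] d.2)) :=
    Multiset.mem_map.2 ⟨g, hg, rfl⟩
  have h2 := congrArg (rename (repL [(repL [e] g.1, repL [e] g.2)])) h
  rw [map_add, map_mul, map_mul, rename_C, rename_C, rename_eprod, rename_eprod, map_zero,
    eprod_map_repL_eq_zero hgm, mul_zero, zero_add] at h2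
  have h3 := (mul_eq_zero.1 h2).resolve_left (MvPolynomial.C_ne_zero.2 hγ)
  by_contra hcon
  refine eprod_ne_zero (fun d'' hd'' => ?_) h3
  obtain ⟨d', hd', rfl⟩ := Multiset.mem_map.1 hd''
  obtain ⟨d, hd, rfl⟩ := Multiset.mem_map.1 hd'
  intro hq
  have hs := eq_or_swap_of_repL_eq (repL [e] g.1, repL [e] g.2) (repL [e] d.1, repL [e] d.2)
    (hll d (hE' d hd).1 (hE' d hd).2) hq
  exact hcon ⟨d, hd, hs.symm⟩

/-- The three-gate form used by the ENGINE: `ρ_e f = 0` with `e` in the first gate and `α₃ ≠ 0` slides the second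
gate into the third. [this file] -/
theorem slide_of_rename_threeGates_eq_zero {E₁ E₂ E₃ : Multiset ((Fin 3 → Fin (qOf m)) × (Fin 3 → Fin (qOf m)))}
    {α₁ α₂ α₃ : ℂ} (hα₃ : α₃ ≠ 0) {e : (Fin 3 → Fin (qOf m)) × (Fin 3 → Fin (qOf m))} (he : e ∈ E₁)
    (hE₃ : ∀ d ∈ E₃, d.1 ≠ d.2 ∧ s(d.1, d.2) ≠ s(e.1, e.2))
    (h : rename (repL [e]) (C α₁ * eprod E₁ + C α₂ * eprod E₂ + C α₃ * eprod E₃) = 0) :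
    ∀ g ∈ E₂, ∃ g' ∈ E₃, Sym2.map (fun c => if c = e.2 then e.1 else c) s(g.1, g.2) =
      Sym2.map (fun c => if c = e.2 then e.1 else c) s(g'.1, g'.2) := by
  refine slide_of_rename_eq_zero (β := α₂) hα₃ e hE₃ ?_
  rw [rename_repL_threeGates he] at h
  rw [map_add, map_mul, map_mul, rename_C, rename_C, rename_eprod, rename_eprod]
  exact h

/-! ## Variables of a circuit term -/

/-- The variables of a gate lie among the endpoints of its edges. [this file] -/
theorem vars_eprod_subset {E : Multiset ((Fin 3 → Fin (qOf m)) × (Fin 3 → Fin (qOf m)))}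
    {T : Finset (Fin 3 → Fin (qOf m))} (hT : ∀ e ∈ E, e.1 ∈ T ∧ e.2 ∈ T) : (eprod E).vars ⊆ T := by
  induction E using Multiset.induction with
  | empty => rw [eprod_zero, ← C_1, vars_C]; exact Finset.empty_subset _
  | cons e E ih =>
    rw [eprod_cons]
    refine (vars_mul _ _).trans (Finset.union_subset ?_ (ih fun d hd => hT d (Multiset.mem_cons_of_mem hd)))
    obtain ⟨h1, h2⟩ := hT e (Multiset.mem_cons_self e E)
    refine (vars_sub_subset _).trans (Finset.union_subset ?_ ?_)
    · rw [vars_X]; exact Finset.singleton_subset_iff.2 h1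
    · rw [vars_X]; exact Finset.singleton_subset_iff.2 h2

/-- The variables of a circuit term lie among the endpoints of its edges. [this file] -/
theorem vars_C_mul_eprod_subset {E : Multiset ((Fin 3 → Fin (qOf m)) × (Fin 3 → Fin (qOf m)))}
    {T : Finset (Fin 3 → Fin (qOf m))} (hT : ∀ e ∈ E, e.1 ∈ T ∧ e.2 ∈ T) (α : ℂ) :
    (C α * eprod E).vars ⊆ T := by
  refine (vars_mul _ _).trans (Finset.union_subset ?_ (vars_eprod_subset hT))
  rw [vars_C]; exact Finset.empty_subset _

/-! ## Level tools for `hB`-patch lists (merged labels pairwise distinct) -/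

/-- SURVIVE at level `L`: one gate on loopless live edges. [this file] -/
theorem bind₁_wordL_eprod_ne_zero {L : List ((Fin 3 → Fin (qOf m)) × (Fin 3 → Fin (qOf m)))}
    (hB : L.Pairwise fun p p' => p.2 ≠ p'.2) (hmL : 2 * 3 ^ L.length < m * m)
    {N : Multiset ((Fin 3 → Fin (qOf m)) × (Fin 3 → Fin (qOf m)))}
    (hN : ∀ e ∈ N, e.1 ≠ e.2 ∧ (∀ p ∈ L, e.1 ≠ p.2) ∧ ∀ p ∈ L, e.2 ≠ p.2) :
    bind₁ (fun c => wordPoly m (wordL m L c)) (eprod N) ≠ 0 := by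
  intro h0
  rw [bind₁_eprod, Multiset.prod_eq_zero_iff, Multiset.mem_map] at h0
  obtain ⟨e, he, h0⟩ := h0
  obtain ⟨hne, hl₁, hl₂⟩ := hN e he
  exact wordPoly_wordL_ne' hB hmL hne hl₁ hl₂ (sub_eq_zero.1 h0)

/-- THE PATCHED SUPPORT RUNG for `hB`-lists (merged-away labels pairwise distinct; no vertex-disjointness). -/
theorem bind₁_wordL_ne_zero' {L : List ((Fin 3 → Fin (qOf m)) × (Fin 3 → Fin (qOf m)))}
    (hB : L.Pairwise fun p p' => p.2 ≠ p'.2) (T : Finset (Fin 3 → Fin (qOf m)))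
    (hT : ∀ c ∈ T, ∀ p ∈ L, c ≠ p.2) (hmT : 2 * 3 ^ L.length * (T.card - 1) < m * m)
    {h : MvPolynomial (Fin 3 → Fin (qOf m)) ℂ} (hh : h ≠ 0) (hvars : h.vars ⊆ T) :
    bind₁ (fun c => wordPoly m (wordL m L c)) h ≠ 0 := by
  have hdes : IsNWDesign (2 * 3 ^ L.length) (fun c : ↥T =>
      (⟨wordCell m (wordL m L c), wordCell_injective (wordL m L c)⟩ :
        Fin m × Fin m ↪ Fin (qOf m) × Fin (qOf m))) := by
    intro c c' hcc'
    have hne : (c : Fin 3 → Fin (qOf m)) ≠ c' := fun e => hcc' (Subtype.ext e)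
    exact (card_cells_inter_le (m := m) (wordL m L c) (wordL m L c')).trans
      (card_agree_wordL_le hB hne (hT _ c.2) (hT _ c'.2))
  obtain ⟨h₀, hh₀⟩ := exists_rename_eq_of_vars_subset_range h ((↑) : ↥T → Fin 3 → Fin (qOf m))
    Subtype.val_injective fun x hx => ⟨⟨x, hvars (Finset.mem_coe.1 hx)⟩, rfl⟩
  have hh₀0 : h₀ ≠ 0 := by
    rintro rfl
    exact hh (by rw [← hh₀, map_zero])
  have hcard : h₀.vars.card ≤ T.card := (Finset.card_le_univ _).trans (Fintype.card_coe T).le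
  have hvars₀ : 2 * 3 ^ L.length * (h₀.vars.card - 1) < m * m :=
    lt_of_le_of_lt (Nat.mul_le_mul_left _ (Nat.sub_le_sub_right hcard 1)) hmT
  have key : bind₁ ((fun c => wordPoly m (wordL m L c)) ∘ ((↑) : ↥T → Fin 3 → Fin (qOf m))) h₀ ≠ 0 := by
    have hfun : ((fun c => wordPoly m (wordL m L c)) ∘ ((↑) : ↥T → Fin 3 → Fin (qOf m))) =
        kiGenerator (perPoly (Fin m) ℂ) (fun c : ↥T =>
          (⟨wordCell m (wordL m L c), wordCell_injective (wordL m L c)⟩ :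
            Fin m × Fin m ↪ Fin (qOf m) × Fin (qOf m))) :=
      funext fun c => rfl
    rw [hfun]
    exact KIPrivate.bind₁_kiGenerator_perPoly_ne_zero (F := ℂ) hdes hh₀0 hvars₀
  rw [← hh₀, bind₁_rename]
  exact key

/-- Liveness of a collapsed label at the next level `e :: L`. [this file] -/
theorem repL_live {L : List ((Fin 3 → Fin (qOf m)) × (Fin 3 → Fin (qOf m)))}
    {e : (Fin 3 → Fin (qOf m)) × (Fin 3 → Fin (qOf m))} (hne : e.1 ≠ e.2) (hl₁ : ∀ p ∈ L, e.1 ≠ p.2)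
    {x : Fin 3 → Fin (qOf m)} (hx : ∀ p ∈ L, x ≠ p.2) : ∀ p ∈ e :: L, repL [e] x ≠ p.2 := by
  intro p hp
  show (if x = e.2 then e.1 else x) ≠ p.2
  by_cases hx' : x = e.2
  · rw [if_pos hx']
    rcases List.mem_cons.1 hp with hp | hp
    · rw [hp]; exact hne
    · exact hl₁ p hp
  · rw [if_neg hx']
    rcases List.mem_cons.1 hp with hp | hp
    · rw [hp]; exact hx'
    · exact hx p hp

/-- The collapsed edges of a gate avoiding `e` (up to orientation) are loopless and live at level `e :: L`.
[this file] -/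
theorem map_repL_cond {L : List ((Fin 3 → Fin (qOf m)) × (Fin 3 → Fin (qOf m)))}
    {e : (Fin 3 → Fin (qOf m)) × (Fin 3 → Fin (qOf m))} (hne : e.1 ≠ e.2) (hl₁ : ∀ p ∈ L, e.1 ≠ p.2)
    {N : Multiset ((Fin 3 → Fin (qOf m)) × (Fin 3 → Fin (qOf m)))}
    (hN : ∀ d ∈ N, d.1 ≠ d.2 ∧ (∀ p ∈ L, d.1 ≠ p.2) ∧ ∀ p ∈ L, d.2 ≠ p.2)
    (hNe : ∀ d ∈ N, s(d.1, d.2) ≠ s(e.1, e.2)) :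
    ∀ d ∈ N.map (fun d => (repL [e] d.1, repL [e] d.2)),
      d.1 ≠ d.2 ∧ (∀ p ∈ e :: L, d.1 ≠ p.2) ∧ ∀ p ∈ e :: L, d.2 ≠ p.2 := by
  intro d' hd'
  obtain ⟨d, hd, rfl⟩ := Multiset.mem_map.1 hd'
  obtain ⟨hdne, hd₁, hd₂⟩ := hN d hd
  exact ⟨fun hq => hNe d hd (eq_or_swap_of_repL_eq e d hdne hq), repL_live hne hl₁ hd₁, repL_live hne hl₁ hd₂⟩

/-- (E2′) MERGE KILLS TWO: an edge `e` lying in the gates `A` and `B` and avoided (up to orientation) by the third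
gate `D` with `d ≠ 0`: `φ_L (a·eprod A + b·eprod B + d·eprod D) ≠ 0` — TRANSFER to `e :: L`, KILL the two gates
through `e`, CONTRACT the third onto its collapse, which SURVIVES. No primality. [this file] -/
theorem bind₁_wordL_ne_zero_of_mem_mem {L : List ((Fin 3 → Fin (qOf m)) × (Fin 3 → Fin (qOf m)))}
    (hB : L.Pairwise fun p p' => p.2 ≠ p'.2) (hmL : 2 * 3 ^ (L.length + 1) < m * m)
    {A B D : Multiset ((Fin 3 → Fin (qOf m)) × (Fin 3 → Fin (qOf m)))} {a b d : ℂ} (hd : d ≠ 0)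
    {e : (Fin 3 → Fin (qOf m)) × (Fin 3 → Fin (qOf m))} (heA : e ∈ A) (heB : e ∈ B)
    (hl : ∀ g ∈ A + B + D, g.1 ≠ g.2 ∧ (∀ p ∈ L, g.1 ≠ p.2) ∧ ∀ p ∈ L, g.2 ≠ p.2)
    (hD : ∀ g ∈ D, s(g.1, g.2) ≠ s(e.1, e.2)) :
    bind₁ (fun c => wordPoly m (wordL m L c)) (C a * eprod A + C b * eprod B + C d * eprod D) ≠ 0 := by
  obtain ⟨hne, hl₁, hl₂⟩ := hl e (Multiset.mem_add.2 (Or.inl (Multiset.mem_add.2 (Or.inl heA))))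
  have hB' : (e :: L).Pairwise fun p p' => p.2 ≠ p'.2 := List.pairwise_cons.2 ⟨hl₂, hB⟩
  have hmL' : 2 * 3 ^ (e :: L).length < m * m := by rw [List.length_cons]; exact hmL
  have he : e ∈ e :: L := List.mem_cons_self
  refine bind₁_wordL_ne_zero_of_cons e ?_
  have hkill : ∀ N : Multiset ((Fin 3 → Fin (qOf m)) × (Fin 3 → Fin (qOf m))), e ∈ N →
      bind₁ (fun c => wordPoly m (wordL m (e :: L) c)) (eprod N) = 0 := fun N heN => by
    rw [bind₁_eprod]
    refine Multiset.prod_eq_zero (Multiset.mem_map.2 ⟨e, heN, ?_⟩)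
    show wordPoly m (wordL m (e :: L) e.1) - wordPoly m (wordL m (e :: L) e.2) = 0
    rw [wordL_snd_eq he, sub_self]
  rw [map_add, map_add, map_mul, map_mul, map_mul, hkill A heA, hkill B heB, mul_zero, mul_zero, zero_add,
    zero_add, bind₁_C_right, ← bind₁_wordL_rename_repL he (eprod D), rename_eprod]
  refine mul_ne_zero (MvPolynomial.C_ne_zero.2 hd) ?_
  exact bind₁_wordL_eprod_ne_zero hB' hmL'
    (map_repL_cond hne hl₁ (fun g hg => hl g (Multiset.mem_add.2 (Or.inr hg))) hD)

/-- (E3a) FREE COLLAPSE: if `e` lies in the first gate, is avoided (up to orientation) by the two others, and the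
collapse `ρ_e f` of the three-gate circuit `f` is NONZERO, then `φ_L f ≠ 0` (`2·3^(|L|+2) < m²`): `ρ_e f` is a
two-gate circuit on loopless edges live at level `e :: L`, so TWO GATES UNDER PATCHES gives
`φ_{e::L} (ρ_e f) ≠ 0`, while `φ_{e::L} ∘ ρ_e = φ_{e::L}` (CONTRACT) and `φ_{e::L} f = mergeSub (φ_L f)` (TRANSFER).
[this file] -/
theorem bind₁_wordL_ne_zero_of_free {L : List ((Fin 3 → Fin (qOf m)) × (Fin 3 → Fin (qOf m)))}
    (hB : L.Pairwise fun p p' => p.2 ≠ p'.2) (hmL : 2 * 3 ^ (L.length + 2) < m * m)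
    {E₁ E₂ E₃ : Multiset ((Fin 3 → Fin (qOf m)) × (Fin 3 → Fin (qOf m)))} {α₁ α₂ α₃ : ℂ}
    {e : (Fin 3 → Fin (qOf m)) × (Fin 3 → Fin (qOf m))} (he : e ∈ E₁)
    (hl : ∀ d ∈ E₁ + E₂ + E₃, d.1 ≠ d.2 ∧ (∀ p ∈ L, d.1 ≠ p.2) ∧ ∀ p ∈ L, d.2 ≠ p.2)
    (h₂ : ∀ d ∈ E₂, s(d.1, d.2) ≠ s(e.1, e.2)) (h₃ : ∀ d ∈ E₃, s(d.1, d.2) ≠ s(e.1, e.2))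
    (hfree : rename (repL [e]) (C α₁ * eprod E₁ + C α₂ * eprod E₂ + C α₃ * eprod E₃) ≠ 0) :
    bind₁ (fun c => wordPoly m (wordL m L c)) (C α₁ * eprod E₁ + C α₂ * eprod E₂ + C α₃ * eprod E₃) ≠ 0 := by
  obtain ⟨hne, hl₁, hl₂⟩ := hl e (Multiset.mem_add.2 (Or.inl (Multiset.mem_add.2 (Or.inl he))))
  have hB' : (e :: L).Pairwise fun p p' => p.2 ≠ p'.2 := List.pairwise_cons.2 ⟨hl₂, hB⟩
  have hmL' : 2 * 3 ^ ((e :: L).length + 1) < m * m := by rw [List.length_cons]; exact hmL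
  have heL : e ∈ e :: L := List.mem_cons_self
  intro h0
  have h1 : bind₁ (fun c => wordPoly m (wordL m (e :: L) c))
      (C α₁ * eprod E₁ + C α₂ * eprod E₂ + C α₃ * eprod E₃) = 0 := by
    rw [← rename_mergeSub_bind₁_wordL L e, h0, map_zero]
  rw [← bind₁_wordL_rename_repL heL, rename_repL_threeGates he] at h1
  rw [rename_repL_threeGates he] at hfree
  exact bind₁_wordL_twoGates_ne_zero hB' hmL' _ _ α₂ α₃
    (fun d hd => by
      rcases Multiset.mem_add.1 hd with hd | hd
      · exact map_repL_cond hne hl₁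
          (fun g hg => hl g (Multiset.mem_add.2 (Or.inl (Multiset.mem_add.2 (Or.inr hg))))) h₂ d hd
      · exact map_repL_cond hne hl₁ (fun g hg => hl g (Multiset.mem_add.2 (Or.inr hg))) h₃ d hd)
    hfree h1

end Summit.ValiantsHypothesis.ValiantsHypothesis.Theorems.DefinabilityGapSlideSupport
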